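import Mathlib.LinearAlgebra.Matrix.DotProduct
import Mathlib.Data.Matrix.Mul
import Mathlib.Data.Real.Basic
import Mathlib.Tactic
import HarnessLib

/-!
# The Kato sector condition for a `2×2` block is one inequality (p5's (L2d) `SectorFormTwoIff`, PROVED) (K1L_D helper)

Helper file of route `SolenoidalFractalHomogenisation`, crux K1L_D `LagrangianRenormalisationStepDesign` (stmt-AnomalousDissipation-27980), registered
stub `stub_cellLawV0_IS` (W5 sectorial window, odd half): planner ad-ideate-p5 g7's certificate chain `Cruxes/LagrangianRenormalisationStep/
OddGainCertificateSketch.lean` (v2 255e48318dac) states as (L2d) `SectorFormTwoIff` — "Stated; the Theorems-side proof is a `nlinarith` exercise" —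
that for a real `2×2` matrix `B` whose symmetric part is positive semidefinite (`0 ≤ B₀₀`, `0 ≤ B₁₁`, `(B₀₁+B₁₀)² ≤ 4 B₀₀B₁₁`) the Kato-sector
condition `SectorForm B τ` (`∀ x y, (xᵀBy − yᵀBx)² ≤ τ²·(xᵀBx)(yᵀBy)`, p5/p4's `sector_inv` hypothesis shape) is EQUIVALENT to the single inequality
`(B₀₁ − B₁₀)² ≤ τ²·det(sym B)`.  This file proves it (`sectorForm_two_iff`, with `SectorForm` unfolded — Theorems files cannot import the Cruxes
workfile; p5's Prop is closed by `fun B τ h₀ h₁ h₂ => sectorForm_two_iff B τ h₀ h₁ h₂`).  Ingredients: the `2×2` identities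
`xᵀBy − yᵀBx = (B₀₁ − B₁₀)·(x₀y₁ − x₁y₀)` and Lagrange/Gram `(xᵀΣx)(yᵀΣy) − (xᵀΣy)² = det Σ·(x₀y₁ − x₁y₀)²` (`Σ = sym B`); for `⇒` the `Σ`-orthogonal
pair `x = e₀`, `y = (−(B₀₁+B₁₀)/2, B₀₀)`.  No definitions, no named facts, no sorry.  NOT a proof of the stub, of the crux, of Onsager's conjecture or
of anomalous dissipation — rung-leaf F-D1.A0 algebra.  Prover seat `ad-k3l-bookkeeping-p1` g4 (O3(ii)), 2026-08-28.
-/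

set_option linter.dupNamespace false

namespace Summit.AnomalousDissipation.AnomalousDissipation.Theorems.SolenoidalFractalHomogenisation.LagrangianStep

open Matrix

/-- The bilinear form of a `2×2` matrix, expanded. [folklore] -/
theorem dotProduct_mulVec_fin_two (B : Matrix (Fin 2) (Fin 2) ℝ) (x y : Fin 2 → ℝ) :
    x ⬝ᵥ B *ᵥ y = B 0 0 * x 0 * y 0 + B 0 1 * x 0 * y 1 + B 1 0 * x 1 * y 0 + B 1 1 * x 1 * y 1 := by
  simp [Matrix.mulVec, dotProduct, Fin.sum_univ_two]
  ring

/-- The antisymmetric part of a `2×2` bilinear form is `(B₀₁ − B₁₀)` times the area form. [folklore] -/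
theorem dotProduct_mulVec_sub_swap_fin_two (B : Matrix (Fin 2) (Fin 2) ℝ) (x y : Fin 2 → ℝ) :
    x ⬝ᵥ B *ᵥ y - y ⬝ᵥ B *ᵥ x = (B 0 1 - B 1 0) * (x 0 * y 1 - x 1 * y 0) := by
  rw [dotProduct_mulVec_fin_two, dotProduct_mulVec_fin_two]
  ring

/-- Lagrange–Gram identity for the symmetric part of a `2×2` form:
`(xᵀBx)(yᵀBy) − ((xᵀBy + yᵀBx)/2)² = (B₀₀B₁₁ − ((B₀₁+B₁₀)/2)²)·(x₀y₁ − x₁y₀)²`. [folklore] -/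
theorem gram_fin_two (B : Matrix (Fin 2) (Fin 2) ℝ) (x y : Fin 2 → ℝ) :
    (x ⬝ᵥ B *ᵥ x) * (y ⬝ᵥ B *ᵥ y) - ((x ⬝ᵥ B *ᵥ y + y ⬝ᵥ B *ᵥ x) / 2) ^ 2 =
      (B 0 0 * B 1 1 - ((B 0 1 + B 1 0) / 2) ^ 2) * (x 0 * y 1 - x 1 * y 0) ^ 2 := by
  rw [dotProduct_mulVec_fin_two, dotProduct_mulVec_fin_two, dotProduct_mulVec_fin_two, dotProduct_mulVec_fin_two]
  ring

/-- **(L2d) PROVED**: for a `2×2` real matrix with positive semidefinite symmetric part, the Kato-sector condition (all `x, y`) is the single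
inequality `(B₀₁ − B₁₀)² ≤ τ²·(B₀₀B₁₁ − ((B₀₁+B₁₀)/2)²)`. [folklore; Kato, Perturbation Theory, V §3.10] -/
theorem sectorForm_two_iff (B : Matrix (Fin 2) (Fin 2) ℝ) (τ : ℝ) (h00 : 0 ≤ B 0 0) (_h11 : 0 ≤ B 1 1)
    (hpsd : (B 0 1 + B 1 0) ^ 2 ≤ 4 * (B 0 0 * B 1 1)) :
    (∀ x y : Fin 2 → ℝ, (x ⬝ᵥ B *ᵥ y - y ⬝ᵥ B *ᵥ x) ^ 2 ≤ τ ^ 2 * ((x ⬝ᵥ B *ᵥ x) * (y ⬝ᵥ B *ᵥ y))) ↔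
      (B 0 1 - B 1 0) ^ 2 ≤ τ ^ 2 * (B 0 0 * B 1 1 - ((B 0 1 + B 1 0) / 2) ^ 2) := by
  have hdet : 0 ≤ B 0 0 * B 1 1 - ((B 0 1 + B 1 0) / 2) ^ 2 := by nlinarith
  constructor
  · intro h
    rcases h00.eq_or_lt with h0 | h0
    · -- `B₀₀ = 0`: then `B₀₁ + B₁₀ = 0` and the sector at `e₀, e₁` forces `B₀₁ = B₁₀`
      have hs : B 0 1 + B 1 0 = 0 := by
        have : (B 0 1 + B 1 0) ^ 2 ≤ 0 := by rw [← h0] at hpsd; simpa using hpsd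
        exact pow_eq_zero_iff (n := 2) (by norm_num) |>.1 (le_antisymm this (sq_nonneg _))
      have h' := h ![1, 0] ![0, 1]
      rw [dotProduct_mulVec_sub_swap_fin_two, dotProduct_mulVec_fin_two, dotProduct_mulVec_fin_two] at h'
      simp at h'
      rw [← h0] at h' ⊢
      have hzero : (B 0 1 - B 1 0) ^ 2 ≤ 0 := by nlinarith
      have hs2 : ((B 0 1 + B 1 0) / 2) ^ 2 = 0 := by rw [hs]; ring
      rw [hs2]
      nlinarith [sq_nonneg τ]
    · -- `B₀₀ > 0`: test with the `Σ`-orthogonal pair `x = e₀`, `y = (−s, B₀₀)`, `s = (B₀₁+B₁₀)/2`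
      have h' := h ![1, 0] ![-((B 0 1 + B 1 0) / 2), B 0 0]
      rw [dotProduct_mulVec_sub_swap_fin_two, dotProduct_mulVec_fin_two, dotProduct_mulVec_fin_two] at h'
      simp only [Matrix.cons_val_zero, Matrix.cons_val_one] at h'
      have e : τ ^ 2 * ((B 0 0 * 1 * 1 + B 0 1 * 1 * 0 + B 1 0 * 0 * 1 + B 1 1 * 0 * 0) *
          (B 0 0 * -((B 0 1 + B 1 0) / 2) * -((B 0 1 + B 1 0) / 2) + B 0 1 * -((B 0 1 + B 1 0) / 2) * B 0 0 +
            B 1 0 * B 0 0 * -((B 0 1 + B 1 0) / 2) + B 1 1 * B 0 0 * B 0 0)) =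
          B 0 0 ^ 2 * (τ ^ 2 * (B 0 0 * B 1 1 - ((B 0 1 + B 1 0) / 2) ^ 2)) := by ring
      have e2 : ((B 0 1 - B 1 0) * (1 * B 0 0 - 0 * -((B 0 1 + B 1 0) / 2))) ^ 2 = B 0 0 ^ 2 * (B 0 1 - B 1 0) ^ 2 := by ring
      have h2 : B 0 0 ^ 2 * (B 0 1 - B 1 0) ^ 2 ≤ B 0 0 ^ 2 * (τ ^ 2 * (B 0 0 * B 1 1 - ((B 0 1 + B 1 0) / 2) ^ 2)) := by
        linarith [h', e, e2]
      exact le_of_mul_le_mul_left h2 (by positivity)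
  · intro h x y
    rw [dotProduct_mulVec_sub_swap_fin_two]
    have hg := gram_fin_two B x y
    have hsym : 0 ≤ ((x ⬝ᵥ B *ᵥ y + y ⬝ᵥ B *ᵥ x) / 2) ^ 2 := sq_nonneg _
    have harea : 0 ≤ (x 0 * y 1 - x 1 * y 0) ^ 2 := sq_nonneg _
    have hτ : 0 ≤ τ ^ 2 := sq_nonneg _
    calc ((B 0 1 - B 1 0) * (x 0 * y 1 - x 1 * y 0)) ^ 2 = (B 0 1 - B 1 0) ^ 2 * (x 0 * y 1 - x 1 * y 0) ^ 2 := by ring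
      _ ≤ τ ^ 2 * (B 0 0 * B 1 1 - ((B 0 1 + B 1 0) / 2) ^ 2) * (x 0 * y 1 - x 1 * y 0) ^ 2 :=
          mul_le_mul_of_nonneg_right h harea
      _ = τ ^ 2 * ((x ⬝ᵥ B *ᵥ x) * (y ⬝ᵥ B *ᵥ y) - ((x ⬝ᵥ B *ᵥ y + y ⬝ᵥ B *ᵥ x) / 2) ^ 2) := by rw [hg]; ring
      _ ≤ τ ^ 2 * ((x ⬝ᵥ B *ᵥ x) * (y ⬝ᵥ B *ᵥ y)) := by nlinarith [mul_nonneg hτ hsym]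

end Summit.AnomalousDissipation.AnomalousDissipation.Theorems.SolenoidalFractalHomogenisation.LagrangianStep
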